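import Summits.ValiantsHypothesis.ValiantsHypothesis.Theorems.DefinabilityGapEdgeGates
import HarnessLib

/-!
# Definability gap — the VERTEX-SUPPORT COUNT for slide identities (pure combinatorics)

Helper-lane file F-N₁ of OFFER O-L5-LEVEL (decomp-val-lens-5 g40; RULING + CALL GO by decomp-val-crit-1 g11) on the
`KIPlantedHittingRO` helper lane (`stmt-ValiantsHypothesis-23704`). This file is PURE COMBINATORICS over a type `β`
with decidable equality (in the applications `β = Fin 3 → Fin (qOf m)`, the block labels): edges are pairs
`g : β × β`, compared as unordered pairs through Mathlib's `Sym2` (`s(g.1, g.2)`), and for an edge `e = (u, v)` the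
COLLAPSE `r_e : v ↦ u` (`fun c => if c = e.2 then e.1 else c`) acts on edges by `Sym2.map r_e`. Two results:

* PARTNER LEMMA `slide_partner`: `r_e` is injective on loopless edges different from `{u, v}` except for the pairs
  `{u, x}, {v, x}` (`x ∉ {u, v}`), which it identifies — a fibre of `Sym2.map r_e` holds at most two loopless classes.
* (CL3) `card_labels_le_four`: three finite families `S₁ S₂ S₃` of loopless edges, pairwise disjoint as unordered
  pairs, `S₁, S₂` nonempty, with the SLIDE PROPERTY in five directed forms `P_ijk` («for every `e ∈ S_i` and
  `g ∈ S_j` some `g' ∈ S_k` has the same `r_e`-collapse as `g`») have ALL their endpoints in a set of at most FOUR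
  labels. Tight: the three perfect matchings of `K₄` (the identity `Δ₁₂Δ₃₄ − Δ₁₃Δ₂₄ + Δ₁₄Δ₂₃ = 0`).

PROOF of (CL3). Fix `e = (u, v) ∈ S₁`. STEP 1 (`P₁₂₃`, `P₁₃₂` + partner lemma): every edge of `S₂ ∪ S₃` is
`{side, outer}` with `side ∈ {u, v}`, `outer ∉ {u, v}`, and its partner `{other side, outer}` lies in the other
family. STEP 2: by `P₂₃₁` + partner lemma an `S₃`-edge meets an `S₂`-edge in exactly one vertex (`meet_one`:
same side iff different outer end); if `g₀ = {a₀, x₀} ∈ S₂` with partner `p₀ = {a₀', x₀} ∈ S₃`, an `S₂`-edge with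
outer end `y ≠ x₀` has side `a₀'`, its partner is `{a₀, y} ∈ S₃`, and a second outer end `z ∉ {x₀, y}` would give an
`S₂`-edge `{a₀', z}` missing `{a₀, y}` — so the outer ends are `x₀` and at most one `y₀` (the `K₄` pattern). STEP 3:
an `S₁`-edge `e'` meets `g₀` and `p₀` in exactly one vertex each (`P₂₁₃`, `P₃₁₂`), hence `e' = {a₀, a₀'} = {u, v}` or
`e' = {x₀, w}` with `w ∉ {u, v, x₀}`; in the latter case the slide `P₁₂₃` at `e'` pairs `g₀` with `{w, a₀} ∈ S₃`, so
`w` is an outer end, `w = y₀`. Hence every endpoint lies in `{u, v, x₀, y₀}`.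

USE (files F-N₂ / F-N₃ of the offer): in the STUCK regime of the free-form dichotomy (every relabel-collapse
`ρ_e : z_v ↦ z_u` kills a three-gate graphical circuit) the collapsed identities yield exactly the slide properties,
so the circuit lives on `≤ 4` block labels and is hit by the (patched) Kabanets–Impagliazzo support rung — a
Dvir–Shpilka-type «identities have low rank» count, exact and elementary for graphic gates. HONEST BOUNDARY: a
combinatorial lemma; 0 S-currency, closes NO item, `stmt-23704` / VP ≠ VNP untouched; the analogue for four or more
families (needed for general fan-in ≥ 4) is NOT here.
-/

set_option linter.dupNamespace false

namespace Summit.ValiantsHypothesis.ValiantsHypothesis.Theorems.DefinabilityGapSlideCount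

variable {β : Type*}

/-- The collapse `r : v ↦ u` fixes an edge avoiding `v`. -/
theorem map_of_ne [DecidableEq β] {u v : β} {d : β × β} (h1 : d.1 ≠ v) (h2 : d.2 ≠ v) :
    Sym2.map (fun c => if c = v then u else c) s(d.1, d.2) = s(d.1, d.2) := by
  show s((if d.1 = v then u else d.1), (if d.2 = v then u else d.2)) = _
  rw [if_neg h1, if_neg h2]

/-- The collapse `r : v ↦ u` sends a loopless edge `{v, x} ≠ {u, v}` to `{u, x}` with `x ∉ {u, v}`. -/
theorem map_of_mem [DecidableEq β] {u v : β} {d : β × β} (hd : d.1 ≠ d.2) (hde : s(d.1, d.2) ≠ s(u, v))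
    (hv : d.1 = v ∨ d.2 = v) :
    ∃ x, x ≠ u ∧ x ≠ v ∧ s(d.1, d.2) = s(v, x) ∧
      Sym2.map (fun c => if c = v then u else c) s(d.1, d.2) = s(u, x) := by
  rcases hv with h | h
  · refine ⟨d.2, fun e => hde ?_, fun e => hd (h.trans e.symm), by rw [h], ?_⟩
    · rw [h, e]; exact Sym2.eq_swap
    · show s((if d.1 = v then u else d.1), (if d.2 = v then u else d.2)) = _
      rw [if_pos h, if_neg (fun e => hd (h.trans e.symm))]
  · refine ⟨d.1, fun e => hde ?_, fun e => hd (e.trans h.symm), by rw [h]; exact Sym2.eq_swap, ?_⟩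
    · rw [h, e]
    · show s((if d.1 = v then u else d.1), (if d.2 = v then u else d.2)) = _
      rw [if_pos h, if_neg (fun e => hd (e.trans h.symm))]; exact Sym2.eq_swap

/-- PARTNER LEMMA: two different loopless edges `≠ {u, v}` with the same `v ↦ u` collapse are `{u, x}` and `{v, x}`
for one `x ∉ {u, v}`. [this file] -/
theorem slide_partner [DecidableEq β] {u v : β} {d d' : β × β} (hd : d.1 ≠ d.2) (hd' : d'.1 ≠ d'.2)
    (hde : s(d.1, d.2) ≠ s(u, v)) (hde' : s(d'.1, d'.2) ≠ s(u, v)) (hdd' : s(d.1, d.2) ≠ s(d'.1, d'.2))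
    (h : Sym2.map (fun c => if c = v then u else c) s(d.1, d.2) =
      Sym2.map (fun c => if c = v then u else c) s(d'.1, d'.2)) :
    ∃ x, x ≠ u ∧ x ≠ v ∧ ((s(d.1, d.2) = s(u, x) ∧ s(d'.1, d'.2) = s(v, x)) ∨
      (s(d.1, d.2) = s(v, x) ∧ s(d'.1, d'.2) = s(u, x))) := by
  by_cases hv : d.1 = v ∨ d.2 = v
  · obtain ⟨x, hxu, hxv, hdx, himg⟩ := map_of_mem hd hde hv
    by_cases hv' : d'.1 = v ∨ d'.2 = v
    · obtain ⟨y, -, -, hdy, himg'⟩ := map_of_mem hd' hde' hv'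
      rw [himg, himg'] at h
      rw [hdx, hdy, Sym2.congr_right.1 h] at hdd'
      exact (hdd' rfl).elim
    · rw [not_or] at hv'
      rw [himg, map_of_ne hv'.1 hv'.2] at h
      exact ⟨x, hxu, hxv, Or.inr ⟨hdx, h.symm⟩⟩
  · rw [not_or] at hv
    by_cases hv' : d'.1 = v ∨ d'.2 = v
    · obtain ⟨y, hyu, hyv, hdy, himg'⟩ := map_of_mem hd' hde' hv'
      rw [himg', map_of_ne hv.1 hv.2] at h
      exact ⟨y, hyu, hyv, Or.inl ⟨h, hdy⟩⟩
    · rw [not_or] at hv'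
      rw [map_of_ne hv.1 hv.2, map_of_ne hv'.1 hv'.2] at h
      exact (hdd' h).elim

/-- Reading «`g'` meets `g = {a, x}` in exactly one vertex, at the far end `w`» in the coordinates `a, x`. -/
theorem meet_cases {a x w : β} {g : β × β} {z : Sym2 β} (hg : s(g.1, g.2) = s(a, x))
    (hw1 : w ≠ g.1) (hw2 : w ≠ g.2) (hm : z = s(g.1, w) ∨ z = s(g.2, w)) :
    w ≠ a ∧ w ≠ x ∧ (z = s(a, w) ∨ z = s(x, w)) := by
  rcases Sym2.eq_iff.1 hg with ⟨h1, h2⟩ | ⟨h1, h2⟩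
  · rw [h1, h2] at hm; rw [h1] at hw1; rw [h2] at hw2
    exact ⟨hw1, hw2, hm⟩
  · rw [h1, h2] at hm; rw [h1] at hw1; rw [h2] at hw2
    exact ⟨hw2, hw1, hm.symm⟩

/-- Two edges `{a, x}`, `{b, y}` with sides `a, b ∈ {u, v}` and outer ends `x, y ∉ {u, v}` that meet in exactly
one vertex: same side iff different outer end. -/
theorem meet_one {u v a b x y w : β} {g g' : β × β} (ha : a = u ∨ a = v) (hb : b = u ∨ b = v)
    (hxu : x ≠ u) (hxv : x ≠ v) (hyu : y ≠ u) (hyv : y ≠ v)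
    (hg : s(g.1, g.2) = s(a, x)) (hg' : s(g'.1, g'.2) = s(b, y)) (hw1 : w ≠ g.1) (hw2 : w ≠ g.2)
    (hm : s(g'.1, g'.2) = s(g.1, w) ∨ s(g'.1, g'.2) = s(g.2, w)) :
    (a = b ∧ x ≠ y) ∨ (a ≠ b ∧ x = y) := by
  obtain ⟨hwa, hwx, hm'⟩ := meet_cases hg hw1 hw2 hm
  rw [hg'] at hm'
  rcases hm' with h | h
  · rcases Sym2.eq_iff.1 h with ⟨h1, h2⟩ | ⟨-, h2⟩
    · exact Or.inl ⟨h1.symm, fun e => hwx (by rw [← h2, ← e])⟩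
    · rcases ha with rfl | rfl
      · exact (hyu h2).elim
      · exact (hyv h2).elim
  · rcases Sym2.eq_iff.1 h with ⟨h1, -⟩ | ⟨h1, h2⟩
    · rcases hb with rfl | rfl
      · exact (hxu h1.symm).elim
      · exact (hxv h1.symm).elim
    · exact Or.inr ⟨fun e => hwa (by rw [← h1, ← e]), h2.symm⟩

/-- (CL3) VERTEX-SUPPORT COUNT: three pairwise disjoint families of loopless edges with the slide property in the
five directions used below have all endpoints among at most four labels (tight at `K₄`). [this file] -/
theorem card_labels_le_four [DecidableEq β] (S₁ S₂ S₃ : Finset (β × β)) (hl : ∀ g ∈ S₁ ∪ S₂ ∪ S₃, g.1 ≠ g.2)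
    (h₁₂ : ∀ g ∈ S₁, ∀ g' ∈ S₂, s(g.1, g.2) ≠ s(g'.1, g'.2))
    (h₁₃ : ∀ g ∈ S₁, ∀ g' ∈ S₃, s(g.1, g.2) ≠ s(g'.1, g'.2))
    (h₂₃ : ∀ g ∈ S₂, ∀ g' ∈ S₃, s(g.1, g.2) ≠ s(g'.1, g'.2)) (hn₁ : S₁.Nonempty) (hn₂ : S₂.Nonempty)
    (P₁₂₃ : ∀ e ∈ S₁, ∀ g ∈ S₂, ∃ g' ∈ S₃, Sym2.map (fun c => if c = e.2 then e.1 else c) s(g.1, g.2) =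
      Sym2.map (fun c => if c = e.2 then e.1 else c) s(g'.1, g'.2))
    (P₁₃₂ : ∀ e ∈ S₁, ∀ g ∈ S₃, ∃ g' ∈ S₂, Sym2.map (fun c => if c = e.2 then e.1 else c) s(g.1, g.2) =
      Sym2.map (fun c => if c = e.2 then e.1 else c) s(g'.1, g'.2))
    (P₂₁₃ : ∀ e ∈ S₂, ∀ g ∈ S₁, ∃ g' ∈ S₃, Sym2.map (fun c => if c = e.2 then e.1 else c) s(g.1, g.2) =
      Sym2.map (fun c => if c = e.2 then e.1 else c) s(g'.1, g'.2))
    (P₂₃₁ : ∀ e ∈ S₂, ∀ g ∈ S₃, ∃ g' ∈ S₁, Sym2.map (fun c => if c = e.2 then e.1 else c) s(g.1, g.2) =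
      Sym2.map (fun c => if c = e.2 then e.1 else c) s(g'.1, g'.2))
    (P₃₁₂ : ∀ e ∈ S₃, ∀ g ∈ S₁, ∃ g' ∈ S₂, Sym2.map (fun c => if c = e.2 then e.1 else c) s(g.1, g.2) =
      Sym2.map (fun c => if c = e.2 then e.1 else c) s(g'.1, g'.2)) :
    ∃ T : Finset β, T.card ≤ 4 ∧ ∀ g ∈ S₁ ∪ S₂ ∪ S₃, g.1 ∈ T ∧ g.2 ∈ T := by
  obtain ⟨e, he⟩ := hn₁
  obtain ⟨g₀, hg₀⟩ := hn₂
  have m1 : ∀ g ∈ S₁, g ∈ S₁ ∪ S₂ ∪ S₃ := fun g hg =>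
    Finset.mem_union_left _ (Finset.mem_union_left _ hg)
  have m2 : ∀ g ∈ S₂, g ∈ S₁ ∪ S₂ ∪ S₃ := fun g hg =>
    Finset.mem_union_left _ (Finset.mem_union_right _ hg)
  have m3 : ∀ g ∈ S₃, g ∈ S₁ ∪ S₂ ∪ S₃ := fun g hg => Finset.mem_union_right _ hg
  -- STEP 1: the edges of `S₂`, `S₃` are `{side, outer}` with a partner of the other side in the other set
  have st2 : ∀ g ∈ S₂, ∃ b x, (b = e.1 ∨ b = e.2) ∧ x ≠ e.1 ∧ x ≠ e.2 ∧ s(g.1, g.2) = s(b, x) ∧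
      ∃ g' ∈ S₃, ∃ b', (b' = e.1 ∨ b' = e.2) ∧ b' ≠ b ∧ s(g'.1, g'.2) = s(b', x) := by
    intro g hg
    obtain ⟨g', hg', himg⟩ := P₁₂₃ e he g hg
    obtain ⟨x, hxu, hxv, hx⟩ := slide_partner (hl g (m2 g hg)) (hl g' (m3 g' hg'))
      (fun h => h₁₂ e he g hg h.symm) (fun h => h₁₃ e he g' hg' h.symm) (h₂₃ g hg g' hg') himg
    rcases hx with ⟨h1, h2⟩ | ⟨h1, h2⟩
    · exact ⟨e.1, x, Or.inl rfl, hxu, hxv, h1, g', hg', e.2, Or.inr rfl, (hl e (m1 e he)).symm, h2⟩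
    · exact ⟨e.2, x, Or.inr rfl, hxu, hxv, h1, g', hg', e.1, Or.inl rfl, hl e (m1 e he), h2⟩
  have st3 : ∀ g ∈ S₃, ∃ b x, (b = e.1 ∨ b = e.2) ∧ x ≠ e.1 ∧ x ≠ e.2 ∧ s(g.1, g.2) = s(b, x) ∧
      ∃ g' ∈ S₂, ∃ b', (b' = e.1 ∨ b' = e.2) ∧ b' ≠ b ∧ s(g'.1, g'.2) = s(b', x) := by
    intro g hg
    obtain ⟨g', hg', himg⟩ := P₁₃₂ e he g hg
    obtain ⟨x, hxu, hxv, hx⟩ := slide_partner (hl g (m3 g hg)) (hl g' (m2 g' hg'))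
      (fun h => h₁₃ e he g hg h.symm) (fun h => h₁₂ e he g' hg' h.symm) (fun h => h₂₃ g' hg' g hg h.symm) himg
    rcases hx with ⟨h1, h2⟩ | ⟨h1, h2⟩
    · exact ⟨e.1, x, Or.inl rfl, hxu, hxv, h1, g', hg', e.2, Or.inr rfl, (hl e (m1 e he)).symm, h2⟩
    · exact ⟨e.2, x, Or.inr rfl, hxu, hxv, h1, g', hg', e.1, Or.inl rfl, hl e (m1 e he), h2⟩
  -- «meets in exactly one vertex»: S₃ vs S₂, S₁ vs S₂, S₁ vs S₃
  have f23 : ∀ g ∈ S₂, ∀ g' ∈ S₃, ∃ w, w ≠ g.1 ∧ w ≠ g.2 ∧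
      (s(g'.1, g'.2) = s(g.1, w) ∨ s(g'.1, g'.2) = s(g.2, w)) := by
    intro g hg g' hg'
    obtain ⟨g₁, hg₁, himg⟩ := P₂₃₁ g hg g' hg'
    obtain ⟨w, hw1, hw2, hw⟩ := slide_partner (hl g' (m3 g' hg')) (hl g₁ (m1 g₁ hg₁))
      (fun h => h₂₃ g hg g' hg' h.symm) (h₁₂ g₁ hg₁ g hg) (fun h => h₁₃ g₁ hg₁ g' hg' h.symm) himg
    rcases hw with ⟨h1, -⟩ | ⟨h1, -⟩
    · exact ⟨w, hw1, hw2, Or.inl h1⟩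
    · exact ⟨w, hw1, hw2, Or.inr h1⟩
  have f21 : ∀ g ∈ S₂, ∀ g' ∈ S₁, ∃ w, w ≠ g.1 ∧ w ≠ g.2 ∧
      (s(g'.1, g'.2) = s(g.1, w) ∨ s(g'.1, g'.2) = s(g.2, w)) := by
    intro g hg g' hg'
    obtain ⟨g₁, hg₁, himg⟩ := P₂₁₃ g hg g' hg'
    obtain ⟨w, hw1, hw2, hw⟩ := slide_partner (hl g' (m1 g' hg')) (hl g₁ (m3 g₁ hg₁))
      (h₁₂ g' hg' g hg) (fun h => h₂₃ g hg g₁ hg₁ h.symm) (h₁₃ g' hg' g₁ hg₁) himg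
    rcases hw with ⟨h1, -⟩ | ⟨h1, -⟩
    · exact ⟨w, hw1, hw2, Or.inl h1⟩
    · exact ⟨w, hw1, hw2, Or.inr h1⟩
  have f31 : ∀ g ∈ S₃, ∀ g' ∈ S₁, ∃ w, w ≠ g.1 ∧ w ≠ g.2 ∧
      (s(g'.1, g'.2) = s(g.1, w) ∨ s(g'.1, g'.2) = s(g.2, w)) := by
    intro g hg g' hg'
    obtain ⟨g₁, hg₁, himg⟩ := P₃₁₂ g hg g' hg'
    obtain ⟨w, hw1, hw2, hw⟩ := slide_partner (hl g' (m1 g' hg')) (hl g₁ (m2 g₁ hg₁))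
      (h₁₃ g' hg' g hg) (h₂₃ g₁ hg₁ g hg) (h₁₂ g' hg' g₁ hg₁) himg
    rcases hw with ⟨h1, -⟩ | ⟨h1, -⟩
    · exact ⟨w, hw1, hw2, Or.inl h1⟩
    · exact ⟨w, hw1, hw2, Or.inr h1⟩
  -- the reference edge `g₀ = {a₀, x₀}` of `S₂` and its partner `p₀ = {a₀', x₀}` in `S₃`
  obtain ⟨a₀, x₀, ha₀, hx₀u, hx₀v, hg₀x, p₀, hp₀, a₀', ha₀', haa, hp₀x⟩ := st2 g₀ hg₀
  -- sides are `u` or `v`: the complement of a side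
  have compl : ∀ b b' c : β, (b = e.1 ∨ b = e.2) → (b' = e.1 ∨ b' = e.2) → (c = e.1 ∨ c = e.2) →
      b' ≠ b → c ≠ b → c = b' := by
    rintro b b' c (rfl | rfl) (rfl | rfl) (rfl | rfl) h h' <;> first | rfl | exact (h rfl).elim | exact (h' rfl).elim
  -- STEP 2: at most one outer end besides `x₀`
  have to2 : ∀ g₁ ∈ S₂, ∀ g₂ ∈ S₂, ∀ b y c z, (b = e.1 ∨ b = e.2) → y ≠ e.1 → y ≠ e.2 →
      s(g₁.1, g₁.2) = s(b, y) → (c = e.1 ∨ c = e.2) → z ≠ e.1 → z ≠ e.2 → s(g₂.1, g₂.2) = s(c, z) →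
      y ≠ x₀ → z ≠ x₀ → z = y := by
    intro g₁ hg₁ g₂ hg₂ b y c z hb hyu hyv hg₁y hc hzu hzv hg₂z hyx hzx
    -- both have the side `a₀'` of `p₀`
    obtain ⟨w₁, hw₁1, hw₁2, hm₁⟩ := f23 g₁ hg₁ p₀ hp₀
    have hb' : b = a₀' := by
      rcases meet_one hb ha₀' hyu hyv hx₀u hx₀v hg₁y hp₀x hw₁1 hw₁2 hm₁ with ⟨h, -⟩ | ⟨-, h⟩
      · exact h
      · exact (hyx h).elim
    obtain ⟨w₂, hw₂1, hw₂2, hm₂⟩ := f23 g₂ hg₂ p₀ hp₀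
    have hc' : c = a₀' := by
      rcases meet_one hc ha₀' hzu hzv hx₀u hx₀v hg₂z hp₀x hw₂1 hw₂2 hm₂ with ⟨h, -⟩ | ⟨-, h⟩
      · exact h
      · exact (hzx h).elim
    -- the partner `p₁ = {a₀, y}` of `g₁`
    obtain ⟨b₁, x₁, hb₁, hx₁u, hx₁v, hg₁x, p₁, hp₁, b₁', hb₁', hbb, hp₁x⟩ := st2 g₁ hg₁
    have hx₁ : x₁ = y := by
      rw [hg₁y] at hg₁x
      rcases Sym2.eq_iff.1 hg₁x with ⟨-, h⟩ | ⟨-, h⟩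
      · exact h.symm
      · rcases hb₁ with rfl | rfl
        · exact (hyu h).elim
        · exact (hyv h).elim
    have hb₁b : b₁ = b := by
      rw [hg₁y] at hg₁x
      rcases Sym2.eq_iff.1 hg₁x with ⟨h, -⟩ | ⟨-, h⟩
      · exact h.symm
      · rcases hb₁ with rfl | rfl
        · exact (hyu h).elim
        · exact (hyv h).elim
    rw [hx₁] at hp₁x
    rw [hb₁b, hb'] at hbb
    obtain ⟨w₃, hw₃1, hw₃2, hm₃⟩ := f23 g₂ hg₂ p₁ hp₁
    rcases meet_one hc hb₁' hzu hzv hyu hyv hg₂z hp₁x hw₃1 hw₃2 hm₃ with ⟨h, -⟩ | ⟨-, h⟩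
    · rw [hc'] at h; exact (hbb h.symm).elim
    · exact h
  -- the second outer end `y₀` (or `x₀` again)
  have key : ∃ y₀, ∀ g ∈ S₂, ∀ b y, (b = e.1 ∨ b = e.2) → y ≠ e.1 → y ≠ e.2 → s(g.1, g.2) = s(b, y) →
      y = x₀ ∨ y = y₀ := by
    by_cases hO : ∃ g ∈ S₂, ∃ b y, (b = e.1 ∨ b = e.2) ∧ y ≠ e.1 ∧ y ≠ e.2 ∧ s(g.1, g.2) = s(b, y) ∧ y ≠ x₀
    · obtain ⟨g₁, hg₁, b, y, hb, hyu, hyv, hg₁y, hyx⟩ := hO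
      refine ⟨y, fun g hg c z hc hzu hzv hgz => ?_⟩
      by_cases hzx : z = x₀
      · exact Or.inl hzx
      · exact Or.inr (to2 g₁ hg₁ g hg b y c z hb hyu hyv hg₁y hc hzu hzv hgz hyx hzx)
    · refine ⟨x₀, fun g hg c z hc hzu hzv hgz => Or.inl ?_⟩
      by_contra hzx
      exact hO ⟨g, hg, c, z, hc, hzu, hzv, hgz, hzx⟩
  obtain ⟨y₀, hy₀⟩ := key
  refine ⟨{e.1, e.2, x₀, y₀}, Finset.card_le_four, ?_⟩
  have memT : ∀ p q : β, p ∈ ({e.1, e.2, x₀, y₀} : Finset β) → q ∈ ({e.1, e.2, x₀, y₀} : Finset β) →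
      ∀ g : β × β, s(g.1, g.2) = s(p, q) →
        g.1 ∈ ({e.1, e.2, x₀, y₀} : Finset β) ∧ g.2 ∈ ({e.1, e.2, x₀, y₀} : Finset β) := by
    intro p q hp hq g hg
    rcases Sym2.eq_iff.1 hg with ⟨h1, h2⟩ | ⟨h1, h2⟩
    · rw [h1, h2]; exact ⟨hp, hq⟩
    · rw [h1, h2]; exact ⟨hq, hp⟩
  have hside : ∀ b : β, (b = e.1 ∨ b = e.2) → b ∈ ({e.1, e.2, x₀, y₀} : Finset β) := by
    rintro b (rfl | rfl) <;> simp
  have hout : ∀ y : β, (y = x₀ ∨ y = y₀) → y ∈ ({e.1, e.2, x₀, y₀} : Finset β) := by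
    rintro y (rfl | rfl) <;> simp
  intro g hg
  rcases Finset.mem_union.1 hg with hg | hg3
  · rcases Finset.mem_union.1 hg with hg1 | hg2
    · -- STEP 3: an edge `e'` of `S₁` is `{u, v}` or `{x₀, y₀}`-supported
      obtain ⟨w, hw1, hw2, hm⟩ := f21 g₀ hg₀ g hg1
      obtain ⟨hwa, hwx, hm⟩ := meet_cases hg₀x hw1 hw2 hm
      obtain ⟨w', hw'1, hw'2, hm'⟩ := f31 p₀ hp₀ g hg1
      obtain ⟨hwa', hwx', hm'⟩ := meet_cases hp₀x hw'1 hw'2 hm'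
      have hax : a₀ ≠ x₀ := by rintro rfl; rcases ha₀ with h | h; exact hx₀u h; exact hx₀v h
      rcases hm with hm | hm
      · -- `e' = {a₀, w}`: then `w = a₀'`
        rw [hm] at hm'
        rcases hm' with hm' | hm'
        · rcases Sym2.eq_iff.1 hm' with ⟨h, -⟩ | ⟨-, h⟩
          · exact (haa h.symm).elim
          · rw [h] at hm; exact memT a₀ a₀' (hside a₀ ha₀) (hside a₀' ha₀') g hm
        · rcases Sym2.eq_iff.1 hm' with ⟨h, -⟩ | ⟨-, h⟩
          · exact (hax h).elim
          · exact (hwx h).elim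
      · -- `e' = {x₀, w}` with `w` outer: `w ∈ {x₀, y₀}` via the slide at `e'`
        rw [hm] at hm'
        have hww : w = w' := by
          rcases hm' with hm' | hm'
          · rcases Sym2.eq_iff.1 hm' with ⟨h, -⟩ | ⟨h, -⟩
            · rcases ha₀' with h' | h'
              · exact (hx₀u (h.trans h')).elim
              · exact (hx₀v (h.trans h')).elim
            · exact (hwx' h.symm).elim
          · exact Sym2.congr_right.1 hm'
        have hwu : w ≠ e.1 := by
          intro h
          have h1 : a₀ = e.2 := by rcases ha₀ with h' | h'; exact (hwa (h.trans h'.symm)).elim; exact h'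
          have h2 : a₀' = e.2 := by
            rcases ha₀' with h' | h'; exact (hwa' (hww.symm.trans (h.trans h'.symm))).elim; exact h'
          exact haa (h2.trans h1.symm)
        have hwv : w ≠ e.2 := by
          intro h
          have h1 : a₀ = e.1 := by rcases ha₀ with h' | h'; exact h'; exact (hwa (h.trans h'.symm)).elim
          have h2 : a₀' = e.1 := by
            rcases ha₀' with h' | h'; exact h'; exact (hwa' (hww.symm.trans (h.trans h'.symm))).elim
          exact haa (h2.trans h1.symm)
        -- the slide at `e'` pairs `g₀` with an edge `{w, a₀}` of `S₃`
        obtain ⟨g', hg', himg⟩ := P₁₂₃ g hg1 g₀ hg₀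
        obtain ⟨x'', -, -, hx''⟩ := slide_partner (hl g₀ (m2 g₀ hg₀)) (hl g' (m3 g' hg'))
          (fun h => h₁₂ g hg1 g₀ hg₀ h.symm) (fun h => h₁₃ g hg1 g' hg' h.symm) (h₂₃ g₀ hg₀ g' hg') himg
        have hg3 : s(g'.1, g'.2) = s(w, a₀) := by
          rcases Sym2.eq_iff.1 hm with ⟨e1, e2⟩ | ⟨e1, e2⟩
          · -- g.1 = x₀, g.2 = w
            rw [e1, e2] at hx''
            rw [hg₀x] at hx''
            rcases hx'' with ⟨h1, h2⟩ | ⟨h1, h2⟩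
            · rcases Sym2.eq_iff.1 h1 with ⟨h, -⟩ | ⟨h, h'⟩
              · exact (hax h).elim
              · rw [h2, h]
            · rcases Sym2.eq_iff.1 h1 with ⟨h, -⟩ | ⟨h, h'⟩
              · exact (hwa h.symm).elim
              · exact (hwx h'.symm).elim
          · -- g.1 = w, g.2 = x₀
            rw [e1, e2] at hx''
            rw [hg₀x] at hx''
            rcases hx'' with ⟨h1, h2⟩ | ⟨h1, h2⟩
            · rcases Sym2.eq_iff.1 h1 with ⟨h, -⟩ | ⟨h, h'⟩
              · exact (hwa h.symm).elim
              · exact (hwx h'.symm).elim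
            · rcases Sym2.eq_iff.1 h1 with ⟨h, -⟩ | ⟨h, h'⟩
              · exact (hax h).elim
              · rw [h2, h]
        obtain ⟨b, x, hb, hxu, hxv, hg'x, g'', hg'', b', hb', -, hg''x⟩ := st3 g' hg'
        have hxw : x = w := by
          rw [hg3] at hg'x
          rcases Sym2.eq_iff.1 hg'x with ⟨h, -⟩ | ⟨h, -⟩
          · rcases hb with h' | h'
            · exact (hwu (h.trans h')).elim
            · exact (hwv (h.trans h')).elim
          · exact h.symm
        rw [hxw] at hg''x
        have hwT := hout w (hy₀ g'' hg'' b' w hb' hwu hwv hg''x)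
        exact memT x₀ w (hout x₀ (Or.inl rfl)) hwT g hm
    · obtain ⟨b, x, hb, hxu, hxv, hgx, -⟩ := st2 g hg2
      exact memT b x (hside b hb) (hout x (hy₀ g hg2 b x hb hxu hxv hgx)) g hgx
  · obtain ⟨b, x, hb, hxu, hxv, hgx, g', hg', b', hb', -, hg'x⟩ := st3 g hg3
    exact memT b x (hside b hb) (hout x (hy₀ g' hg' b' x hb' hxu hxv hg'x)) g hgx

end Summit.ValiantsHypothesis.ValiantsHypothesis.Theorems.DefinabilityGapSlideCount
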